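import Summits.QuantumFields.BalabanUV.Beta.FP.CoarseJetOrderTwoGradedCombJunctionRecord
import Summits.QuantumFields.BalabanUV.Beta.CombHId2TorusTwinSlots

/-!
# `BalabanUV.Beta.FP.CoarseJetOrderTwoGradedCombJunctionRecordAn1` — road «FP» (binder row D1), ROUTE T, junction J2 AT an1's RECORD (leaf-05's W-1, the instance):
# **THE DOOR's `hId₂` POLYNOMIAL AT `tabs := symTablesAn1S2 d Lc cΛ′` IN CLOSED FORM — ALL SIX PARITY SOCKETS AND THE SPLIT DISCHARGED BY an2's LETTERS 2c-iii∕2d∕2d-bis,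
# THE BORDER COMPANION ERASED ON THE COARSE `ff` BLOCK**

WHY.  `CoarseJetOrderTwoGradedCombJunctionRecord.torus_thetaWord_record_comb` (p360831 ✓) states the door's `hId₂` polynomial at the chart-(III′) record for ANY
`tabs : SymTables d Lc`, MODULO a split `Ŵ = Ŵ^{slots} + Ẑ` and six block letters (zero `μμ` blocks; `D̂`, `Ẑ` symmetric-twin; `Ŵ^{slots}` anti-twin).  At an1's record
every letter is a theorem of the lattice side BY NAME: the split is an2's `CombHId2TorusRecord.perF_W2SymOfK_comb` + `perF_W2OfK_comb` (2c-iii) with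
`Ŵ^{slots}_{b̄b̄′} := ½ • ((V̂₂(b̄,b̄′) + M̂ix(b̄,b̄′) + M̂ix(b̄′,b̄)) + (b̄ ↔ b̄′))`, `Ẑ_{b̄b̄′} := ½ • (R̂(b̄′;b̄) + R̂(b̄;b̄′))`; the first jet's letters are
`CombHId2TorusTwin.perF_dM_comb_an1_inr_inr ∕ _twin` (2d, L1a∕L2a), the response word's `perF_resp_comb_an1_inr_inr ∕ _twin` (2d, L1c∕L2c), the slot words'
`CombHId2TorusTwinSlots.perF_vertex2OfK_comb_an1_inr_inr ∕ _antitwin` and `perF_mixOfK_comb_an1_inr_left ∕ _inr_right` (2d-bis); and the crown's border companion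
`(cB·wB2)·perF M′(vh₂S^{per,cs})` has NO coarse `ff` entry at this record (`SymSecondOrderTablesAn1.symTablesAn1S2_vh₂S_inl_inl`, generic `d`; an2's
`CombHId2TorusRecordAn1.border₂_an1_inl_inl_eq_zero` is the `d = 3` print).  [folklore] `Matrix.ext` + entry letters BY NAME; no `def`, no `def … : Prop`, nothing cited, 0 sorry.
WHAT: §1 the letters in J2-record's BLOCK currency (`Dh_blocks`, `Ws_blocks`, `Wz_blocks`, `Wh_split`) and `border₂_ff_sum_eq_zero`;
§2 (P0) for the door's binders: `perF_GcombSh_inr_inr_symm`, `door_ΘL_eq_neg_transpose`, `door_Ŝ_transpose`, `door_responseBorder_transpose` (the displayed response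
sandwich's border share `Θᴸ·Qᶻᵀ·Ŝ + Ŝ·Qᶻ·Θ` is ANTISYMMETRIC — invisible to the door's symmetric `c • H′₂`); §3 **`torus_thetaWord_record_an1`**: for the door's binders `Θ Θᴸ Ŝ Γ̂` (VERBATIM), the jets READ off `D̂_v`, `Ŵ^{slots}_{vv}`, `Ẑ_{vv}` (VERBATIM), all coarse slots `a₁ a₂`:
`(cE₂·wV4 (j+1)) · (P(Θ,Θᴸ,Ŝ,Γ̂; H₁,H₂,Q₁₁,Q₁₂) − (Θᴸ·Hᶻ·Θ + Θᴸ·Qᶻᵀ·Ŝ + Ŝ·Qᶻ·Θ)) a₁ a₂ = Σ_{b̄ b̄′} v_{b̄} v_{b̄′} · perF M′ (dper M′ (Σ'_n T2_{j+1} b̄ (b̄′+M′∘n))) (a₁.1, inl a₁.2) (a₂.1, inl a₂.2)`.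
HONEST DEPENDENCY (page 1, mandatory): continuum YM on T⁴ ⇐ BetaPertH ∧ nine spine estimates (0/9 proved); BetaPertH ⇐ (D1) ∧ (D4) ∧ CAP+tail;
G-an2-4 gates asym, D1 and NE2/3/4.  Discharges NO binder of row D1 and NO row of the door (it rewrites `hId₂`'s left side at the record; `H′₂`'s identification with the
assembled coarse table is the OWNER's #39∕#40); NOT the dictionary's `hId₂`, NOT (J-a), NOT (T-ID), NOT SDF, NOT D1, NEVER «G-an2-4 closed», NOT BetaPertH, NOT continuum,
NOT Clay; 0 estimates.  «not in print; our bookkeeping».  Unit `b2b-balaban-beta-d1-formalise-leaf-05` (gen 36), 2026-08-23; no existing file touched.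
-/

noncomputable section

open scoped BigOperators Matrix

namespace Summit.QuantumFields.BalabanUV.Beta.FP.CoarseJetOrderTwoGradedCombJunctionRecordAn1

open Matrix
open Literature.MathematicalPhysics.QuantumFieldTheory.Balaban1983to89
open Literature.MathematicalPhysics.QuantumFieldTheory.Balaban1983to89.Beta
open B4TorusKernel.MultiPeriod (translate)
open ExpKernelCalculus (MKer)
open AffineAveraging (Site)
open OneStepResolventKernel (Fib)
open BalabanStepW2 (wV4 wB2 M2Of)
open SecondOrderResponse (dM K2OfK vertex2OfK mixOfK W2OfK W2SymOfK)
open Summit.QuantumFields.BalabanUV.Beta.SpineRooted (T2RecOf)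
open Summit.QuantumFields.BalabanUV.Beta.FP.KernelPeriodisationFib (Idx perF perF_apply perZ_apply)
open Summit.QuantumFields.BalabanUV.Beta.FP.KernelPeriodisationFibLoc (dper dper_apply)
open Summit.QuantumFields.BalabanUV.Beta.SymSecondOrderTablesAn1 (symTablesAn1S2 symTablesAn1S2_vh₂S_inl_inl)
open Summit.QuantumFields.BalabanUV.Beta.CombChartStepJets (GcombSh SpureCombOf)
open B6Lemma24Torus (pbox)
open AveragingContoursRooted (ctr)
open B5Prop11Plancherel (fine)
open Summit.QuantumFields.BalabanUV.Beta.AxialDressingRooted (axEc)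
open Summit.QuantumFields.BalabanUV.Beta.FP.TorusGaugeCovarianceCoarse (coarsePt)
open Summit.QuantumFields.BalabanUV.Beta.CombHId2TorusRecord (perF_W2SymOfK_comb perF_W2OfK_comb)
open Summit.QuantumFields.BalabanUV.Beta.CombHId2TorusTwin (perF_twin_of_twin perF_dM_comb_an1_inr_inr perF_dM_comb_an1_twin perF_resp_comb_an1_inr_inr
  perF_resp_comb_an1_twin perF_GcombSh_border_antitwin)
open Summit.QuantumFields.BalabanUV.Beta.CombHId2Record (translate_inv_GcombSh)
open Summit.QuantumFields.BalabanUV.Beta.CombChartWardSockets (trK_GcombSh)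
open Summit.QuantumFields.BalabanUV.Beta.TameKernelCalculus (trK_apply)
open Summit.QuantumFields.BalabanUV.Beta.BorderedHessian (sgnK_apply sgnF_inr)
open Summit.QuantumFields.BalabanUV.Beta.CombHId2TorusTwinSlots (perF_vertex2OfK_comb_an1_inr_inr perF_vertex2OfK_comb_an1_antitwin
  perF_mixOfK_comb_an1_inr_left perF_mixOfK_comb_an1_inr_right)
open Summit.QuantumFields.BalabanUV.Beta.FP.CoarseJetOrderTwoGradedCombJunctionRecord (torus_thetaWord_record_comb responseBorder_transpose)

variable {d : ℕ} {Lc : ℕ} [NeZero Lc] (M' : Fin (d + 1) → ℕ) [∀ μ, NeZero (M' μ)] (cΛ' cE cVH cΛ cE₂ cB : ℝ) (T : Fin 4 → Fin 4 → Fin 4 → Fin 4 → ℝ)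

/-! ## §1 an2's letters in J2-record's block currency, at an1's record `tabs := symTablesAn1S2 d Lc cΛ′` on the fine box `fine Lc M′` -/

section Letters

/-- [folklore] **(L1a)∕(L2a) in block form**: the first jet `D̂_b̄` has no `μμ` block at the coarse slots and its `(f, μ)` block is the transpose of its `(μ, f)` block
(`CombHId2TorusTwin.perF_dM_comb_an1_inr_inr ∕ _twin`). -/
theorem Dh_blocks (j : ℕ) {Dh : ↥(pbox M') × Fin (d + 1) → Matrix (Idx (fine Lc M') (Fib d)) (Idx (fine Lc M') (Fib d)) ℝ}
    (hDh : Dh = fun b => perF (fine Lc M') (dM (GcombSh (d := d) Lc j) Lc (fun κ u => dper (fine Lc M') (SpureCombOf (symTablesAn1S2 d Lc cΛ') cE cVH cΛ j κ u))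
        (fun ρ w => dper (fine Lc M') ((symTablesAn1S2 d Lc cΛ').M j ρ w)) b.2 (b.1 : Site (d + 1)))) :
    (∀ b, (Dh b).submatrix (fun a : ↥(pbox M') × Fin (d + 1) => ((coarsePt M' Lc a.1, Sum.inr a.2) : Idx (fine Lc M') (Fib d)))
        (fun a : ↥(pbox M') × Fin (d + 1) => ((coarsePt M' Lc a.1, Sum.inr a.2) : Idx (fine Lc M') (Fib d))) = 0)
    ∧ ∀ b, (Dh b).submatrix (fun b : ↥(pbox (fine Lc M')) × Fin (d + 1) => ((b.1, Sum.inl b.2) : Idx (fine Lc M') (Fib d)))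
        (fun a : ↥(pbox M') × Fin (d + 1) => ((coarsePt M' Lc a.1, Sum.inr a.2) : Idx (fine Lc M') (Fib d)))
      = ((Dh b).submatrix (fun a : ↥(pbox M') × Fin (d + 1) => ((coarsePt M' Lc a.1, Sum.inr a.2) : Idx (fine Lc M') (Fib d)))
          (fun b : ↥(pbox (fine Lc M')) × Fin (d + 1) => ((b.1, Sum.inl b.2) : Idx (fine Lc M') (Fib d))))ᵀ := by
  subst hDh
  refine ⟨fun b => ?_, fun b => ?_⟩
  · ext a a'
    simp only [Matrix.submatrix_apply, Matrix.zero_apply]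
    exact perF_dM_comb_an1_inr_inr (fine Lc M') cΛ' cE cVH cΛ j b.2 (b.1 : Site (d + 1)) _ _ a.2 a'.2
  · ext b₁ a
    simp only [Matrix.submatrix_apply, Matrix.transpose_apply]
    exact (perF_dM_comb_an1_twin (fine Lc M') cΛ' cE cVH cΛ (fun i => rfl) j b.2 (b.1 : Site (d + 1)) (coarsePt M' Lc a.1) b₁.1 b₁.2 a.2).symm

omit [∀ μ, NeZero (M' μ)] in
/-- [folklore] **(L1b)∕(L2b-slots) in block form**: the slot word `Ŵ^{slots}_{b̄b̄′} := ½ • ((V̂₂(b̄,b̄′) + M̂ix(b̄,b̄′) + M̂ix(b̄′,b̄)) + (b̄ ↔ b̄′))` has no `μμ` block and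
its `(f, μ)` block is MINUS the transpose of its `(μ, f)` block (`CombHId2TorusTwinSlots.perF_vertex2OfK_comb_an1_inr_inr ∕ _antitwin`; the mixed words have no border
at all: `perF_mixOfK_comb_an1_inr_left ∕ _inr_right`). -/
theorem Ws_blocks (j : ℕ) {Ws : ↥(pbox M') × Fin (d + 1) → ↥(pbox M') × Fin (d + 1) → Matrix (Idx (fine Lc M') (Fib d)) (Idx (fine Lc M') (Fib d)) ℝ}
    (hWs : Ws = fun b b' => (1 / 2 : ℝ) •
        ((perF (fine Lc M') (vertex2OfK (GcombSh (d := d) Lc j) Lc (fun κ u κ' u' => dper (fine Lc M') (fun x z a c => ∑' n : Site (d + 1),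
              T2RecOf d Lc (GcombSh Lc) (SpureCombOf (symTablesAn1S2 d Lc cΛ') cE cVH cΛ) (symTablesAn1S2 d Lc cΛ').M cE₂ cB T (symTablesAn1S2 d Lc cΛ').vh₂S
                (symTablesAn1S2 d Lc cΛ').mixFF j κ u κ' (translate (fine Lc M') u' n) x z a c)) b.2 (b.1 : Site (d + 1)) b'.2 (b'.1 : Site (d + 1)))
            + perF (fine Lc M') (mixOfK (GcombSh (d := d) Lc j) Lc
                (fun κ u ρ w => dper (fine Lc M') (fun x z a c => ∑' n : Site (d + 1), M2Of d Lc (symTablesAn1S2 d Lc cΛ').mixFF j κ u ρ (translate M' w n) x z a c))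
                b.2 (b.1 : Site (d + 1)) b'.2 (b'.1 : Site (d + 1)))
            + perF (fine Lc M') (mixOfK (GcombSh (d := d) Lc j) Lc
                (fun κ u ρ w => dper (fine Lc M') (fun x z a c => ∑' n : Site (d + 1), M2Of d Lc (symTablesAn1S2 d Lc cΛ').mixFF j κ u ρ (translate M' w n) x z a c))
                b'.2 (b'.1 : Site (d + 1)) b.2 (b.1 : Site (d + 1))))
          + (perF (fine Lc M') (vertex2OfK (GcombSh (d := d) Lc j) Lc (fun κ u κ' u' => dper (fine Lc M') (fun x z a c => ∑' n : Site (d + 1),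
              T2RecOf d Lc (GcombSh Lc) (SpureCombOf (symTablesAn1S2 d Lc cΛ') cE cVH cΛ) (symTablesAn1S2 d Lc cΛ').M cE₂ cB T (symTablesAn1S2 d Lc cΛ').vh₂S
                (symTablesAn1S2 d Lc cΛ').mixFF j κ u κ' (translate (fine Lc M') u' n) x z a c)) b'.2 (b'.1 : Site (d + 1)) b.2 (b.1 : Site (d + 1)))
            + perF (fine Lc M') (mixOfK (GcombSh (d := d) Lc j) Lc
                (fun κ u ρ w => dper (fine Lc M') (fun x z a c => ∑' n : Site (d + 1), M2Of d Lc (symTablesAn1S2 d Lc cΛ').mixFF j κ u ρ (translate M' w n) x z a c))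
                b'.2 (b'.1 : Site (d + 1)) b.2 (b.1 : Site (d + 1)))
            + perF (fine Lc M') (mixOfK (GcombSh (d := d) Lc j) Lc
                (fun κ u ρ w => dper (fine Lc M') (fun x z a c => ∑' n : Site (d + 1), M2Of d Lc (symTablesAn1S2 d Lc cΛ').mixFF j κ u ρ (translate M' w n) x z a c))
                b.2 (b.1 : Site (d + 1)) b'.2 (b'.1 : Site (d + 1)))))) :
    (∀ b b', (Ws b b').submatrix (fun a : ↥(pbox M') × Fin (d + 1) => ((coarsePt M' Lc a.1, Sum.inr a.2) : Idx (fine Lc M') (Fib d)))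
        (fun a : ↥(pbox M') × Fin (d + 1) => ((coarsePt M' Lc a.1, Sum.inr a.2) : Idx (fine Lc M') (Fib d))) = 0)
    ∧ ∀ b b', (Ws b b').submatrix (fun b : ↥(pbox (fine Lc M')) × Fin (d + 1) => ((b.1, Sum.inl b.2) : Idx (fine Lc M') (Fib d)))
        (fun a : ↥(pbox M') × Fin (d + 1) => ((coarsePt M' Lc a.1, Sum.inr a.2) : Idx (fine Lc M') (Fib d)))
      = -((Ws b b').submatrix (fun a : ↥(pbox M') × Fin (d + 1) => ((coarsePt M' Lc a.1, Sum.inr a.2) : Idx (fine Lc M') (Fib d)))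
          (fun b : ↥(pbox (fine Lc M')) × Fin (d + 1) => ((b.1, Sum.inl b.2) : Idx (fine Lc M') (Fib d))))ᵀ := by
  subst hWs
  refine ⟨fun b b' => ?_, fun b b' => ?_⟩
  · ext a a'
    simp only [Matrix.submatrix_apply, Matrix.zero_apply, Matrix.smul_apply, Matrix.add_apply, smul_eq_mul, perF_vertex2OfK_comb_an1_inr_inr,
      perF_mixOfK_comb_an1_inr_left, add_zero, mul_zero]
  · ext b₁ a
    simp only [Matrix.submatrix_apply, Matrix.transpose_apply, Matrix.neg_apply, Matrix.smul_apply, Matrix.add_apply, smul_eq_mul,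
      perF_mixOfK_comb_an1_inr_left, perF_mixOfK_comb_an1_inr_right, add_zero]
    rw [perF_vertex2OfK_comb_an1_antitwin (fine Lc M') cΛ' cE cVH cΛ cE₂ cB T j b.2 (b.1 : Site (d + 1)) b'.2 (b'.1 : Site (d + 1)) (coarsePt M' Lc a.1) b₁.1 b₁.2 a.2,
      perF_vertex2OfK_comb_an1_antitwin (fine Lc M') cΛ' cE cVH cΛ cE₂ cB T j b'.2 (b'.1 : Site (d + 1)) b.2 (b.1 : Site (d + 1)) (coarsePt M' Lc a.1) b₁.1 b₁.2 a.2]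
    ring

/-- [folklore] **(L1c)∕(L2c) in block form**: the symmetrised response word `Ẑ_{b̄b̄′} := ½ • (R̂(b̄′;b̄) + R̂(b̄;b̄′))`, `R̂(b̄′;b̄) := perF F (dM (K2OfK G Lc S^per M^per b̄′) Lc S^per M^per b̄)`,
has no `μμ` block and its `(f, μ)` block is the transpose of its `(μ, f)` block (`CombHId2TorusTwin.perF_resp_comb_an1_inr_inr ∕ _twin`). -/
theorem Wz_blocks (j : ℕ) {Wz : ↥(pbox M') × Fin (d + 1) → ↥(pbox M') × Fin (d + 1) → Matrix (Idx (fine Lc M') (Fib d)) (Idx (fine Lc M') (Fib d)) ℝ}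
    (hWz : Wz = fun b b' => (1 / 2 : ℝ) •
        (perF (fine Lc M') (dM (K2OfK (GcombSh (d := d) Lc j) Lc (fun κ u => dper (fine Lc M') (SpureCombOf (symTablesAn1S2 d Lc cΛ') cE cVH cΛ j κ u))
              (fun ρ w => dper (fine Lc M') ((symTablesAn1S2 d Lc cΛ').M j ρ w)) b'.2 (b'.1 : Site (d + 1))) Lc
            (fun κ u => dper (fine Lc M') (SpureCombOf (symTablesAn1S2 d Lc cΛ') cE cVH cΛ j κ u)) (fun ρ w => dper (fine Lc M') ((symTablesAn1S2 d Lc cΛ').M j ρ w))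
            b.2 (b.1 : Site (d + 1)))
          + perF (fine Lc M') (dM (K2OfK (GcombSh (d := d) Lc j) Lc (fun κ u => dper (fine Lc M') (SpureCombOf (symTablesAn1S2 d Lc cΛ') cE cVH cΛ j κ u))
              (fun ρ w => dper (fine Lc M') ((symTablesAn1S2 d Lc cΛ').M j ρ w)) b.2 (b.1 : Site (d + 1))) Lc
            (fun κ u => dper (fine Lc M') (SpureCombOf (symTablesAn1S2 d Lc cΛ') cE cVH cΛ j κ u)) (fun ρ w => dper (fine Lc M') ((symTablesAn1S2 d Lc cΛ').M j ρ w))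
            b'.2 (b'.1 : Site (d + 1))))) :
    (∀ b b', (Wz b b').submatrix (fun a : ↥(pbox M') × Fin (d + 1) => ((coarsePt M' Lc a.1, Sum.inr a.2) : Idx (fine Lc M') (Fib d)))
        (fun a : ↥(pbox M') × Fin (d + 1) => ((coarsePt M' Lc a.1, Sum.inr a.2) : Idx (fine Lc M') (Fib d))) = 0)
    ∧ ∀ b b', (Wz b b').submatrix (fun b : ↥(pbox (fine Lc M')) × Fin (d + 1) => ((b.1, Sum.inl b.2) : Idx (fine Lc M') (Fib d)))
        (fun a : ↥(pbox M') × Fin (d + 1) => ((coarsePt M' Lc a.1, Sum.inr a.2) : Idx (fine Lc M') (Fib d)))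
      = ((Wz b b').submatrix (fun a : ↥(pbox M') × Fin (d + 1) => ((coarsePt M' Lc a.1, Sum.inr a.2) : Idx (fine Lc M') (Fib d)))
          (fun b : ↥(pbox (fine Lc M')) × Fin (d + 1) => ((b.1, Sum.inl b.2) : Idx (fine Lc M') (Fib d))))ᵀ := by
  subst hWz
  refine ⟨fun b b' => ?_, fun b b' => ?_⟩
  · ext a a'
    simp only [Matrix.submatrix_apply, Matrix.zero_apply, Matrix.smul_apply, Matrix.add_apply, smul_eq_mul, perF_resp_comb_an1_inr_inr, add_zero, mul_zero]
  · ext b₁ a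
    simp only [Matrix.submatrix_apply, Matrix.transpose_apply, Matrix.smul_apply, Matrix.add_apply, smul_eq_mul]
    rw [perF_resp_comb_an1_twin (fine Lc M') cΛ' cE cVH cΛ (fun i => rfl) j b.2 (b.1 : Site (d + 1)) b'.2 (b'.1 : Site (d + 1)) (coarsePt M' Lc a.1) b₁.1 b₁.2 a.2,
      perF_resp_comb_an1_twin (fine Lc M') cΛ' cE cVH cΛ (fun i => rfl) j b'.2 (b'.1 : Site (d + 1)) b.2 (b.1 : Site (d + 1)) (coarsePt M' Lc a.1) b₁.1 b₁.2 a.2]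

/-- [folklore] **THE SPLIT `Ŵ = Ŵ^{slots} + Ẑ` at the record** (an2's 2c-iii `CombHId2TorusRecord.perF_W2SymOfK_comb` + `perF_W2OfK_comb`, regrouped). -/
theorem Wh_split (j : ℕ) (b b' : ↥(pbox M') × Fin (d + 1)) :
    perF (fine Lc M') (W2SymOfK (GcombSh (d := d) Lc j) Lc (fun κ u => dper (fine Lc M') (SpureCombOf (symTablesAn1S2 d Lc cΛ') cE cVH cΛ j κ u))
        (fun ρ w => dper (fine Lc M') ((symTablesAn1S2 d Lc cΛ').M j ρ w))
        (fun κ u κ' u' => dper (fine Lc M') (fun x z a c => ∑' n : Site (d + 1),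
          T2RecOf d Lc (GcombSh Lc) (SpureCombOf (symTablesAn1S2 d Lc cΛ') cE cVH cΛ) (symTablesAn1S2 d Lc cΛ').M cE₂ cB T (symTablesAn1S2 d Lc cΛ').vh₂S
            (symTablesAn1S2 d Lc cΛ').mixFF j κ u κ' (translate (fine Lc M') u' n) x z a c))
        (fun κ u ρ w => dper (fine Lc M') (fun x z a c => ∑' n : Site (d + 1), M2Of d Lc (symTablesAn1S2 d Lc cΛ').mixFF j κ u ρ (translate M' w n) x z a c))
        b.2 (b.1 : Site (d + 1)) b'.2 (b'.1 : Site (d + 1)))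
      = (1 / 2 : ℝ) •
        ((perF (fine Lc M') (vertex2OfK (GcombSh (d := d) Lc j) Lc (fun κ u κ' u' => dper (fine Lc M') (fun x z a c => ∑' n : Site (d + 1),
              T2RecOf d Lc (GcombSh Lc) (SpureCombOf (symTablesAn1S2 d Lc cΛ') cE cVH cΛ) (symTablesAn1S2 d Lc cΛ').M cE₂ cB T (symTablesAn1S2 d Lc cΛ').vh₂S
                (symTablesAn1S2 d Lc cΛ').mixFF j κ u κ' (translate (fine Lc M') u' n) x z a c)) b.2 (b.1 : Site (d + 1)) b'.2 (b'.1 : Site (d + 1)))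
            + perF (fine Lc M') (mixOfK (GcombSh (d := d) Lc j) Lc
                (fun κ u ρ w => dper (fine Lc M') (fun x z a c => ∑' n : Site (d + 1), M2Of d Lc (symTablesAn1S2 d Lc cΛ').mixFF j κ u ρ (translate M' w n) x z a c))
                b.2 (b.1 : Site (d + 1)) b'.2 (b'.1 : Site (d + 1)))
            + perF (fine Lc M') (mixOfK (GcombSh (d := d) Lc j) Lc
                (fun κ u ρ w => dper (fine Lc M') (fun x z a c => ∑' n : Site (d + 1), M2Of d Lc (symTablesAn1S2 d Lc cΛ').mixFF j κ u ρ (translate M' w n) x z a c))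
                b'.2 (b'.1 : Site (d + 1)) b.2 (b.1 : Site (d + 1))))
          + (perF (fine Lc M') (vertex2OfK (GcombSh (d := d) Lc j) Lc (fun κ u κ' u' => dper (fine Lc M') (fun x z a c => ∑' n : Site (d + 1),
              T2RecOf d Lc (GcombSh Lc) (SpureCombOf (symTablesAn1S2 d Lc cΛ') cE cVH cΛ) (symTablesAn1S2 d Lc cΛ').M cE₂ cB T (symTablesAn1S2 d Lc cΛ').vh₂S
                (symTablesAn1S2 d Lc cΛ').mixFF j κ u κ' (translate (fine Lc M') u' n) x z a c)) b'.2 (b'.1 : Site (d + 1)) b.2 (b.1 : Site (d + 1)))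
            + perF (fine Lc M') (mixOfK (GcombSh (d := d) Lc j) Lc
                (fun κ u ρ w => dper (fine Lc M') (fun x z a c => ∑' n : Site (d + 1), M2Of d Lc (symTablesAn1S2 d Lc cΛ').mixFF j κ u ρ (translate M' w n) x z a c))
                b'.2 (b'.1 : Site (d + 1)) b.2 (b.1 : Site (d + 1)))
            + perF (fine Lc M') (mixOfK (GcombSh (d := d) Lc j) Lc
                (fun κ u ρ w => dper (fine Lc M') (fun x z a c => ∑' n : Site (d + 1), M2Of d Lc (symTablesAn1S2 d Lc cΛ').mixFF j κ u ρ (translate M' w n) x z a c))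
                b.2 (b.1 : Site (d + 1)) b'.2 (b'.1 : Site (d + 1)))))
        + (1 / 2 : ℝ) •
          (perF (fine Lc M') (dM (K2OfK (GcombSh (d := d) Lc j) Lc (fun κ u => dper (fine Lc M') (SpureCombOf (symTablesAn1S2 d Lc cΛ') cE cVH cΛ j κ u))
                (fun ρ w => dper (fine Lc M') ((symTablesAn1S2 d Lc cΛ').M j ρ w)) b'.2 (b'.1 : Site (d + 1))) Lc
              (fun κ u => dper (fine Lc M') (SpureCombOf (symTablesAn1S2 d Lc cΛ') cE cVH cΛ j κ u)) (fun ρ w => dper (fine Lc M') ((symTablesAn1S2 d Lc cΛ').M j ρ w))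
              b.2 (b.1 : Site (d + 1)))
            + perF (fine Lc M') (dM (K2OfK (GcombSh (d := d) Lc j) Lc (fun κ u => dper (fine Lc M') (SpureCombOf (symTablesAn1S2 d Lc cΛ') cE cVH cΛ j κ u))
                (fun ρ w => dper (fine Lc M') ((symTablesAn1S2 d Lc cΛ').M j ρ w)) b.2 (b.1 : Site (d + 1))) Lc
              (fun κ u => dper (fine Lc M') (SpureCombOf (symTablesAn1S2 d Lc cΛ') cE cVH cΛ j κ u)) (fun ρ w => dper (fine Lc M') ((symTablesAn1S2 d Lc cΛ').M j ρ w))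
              b'.2 (b'.1 : Site (d + 1)))) := by
  have hM : ∀ i, fine Lc M' i = Lc * M' i := fun i => rfl
  rw [perF_W2SymOfK_comb (fine Lc M') (symTablesAn1S2 d Lc cΛ') cE cVH cΛ cE₂ cB T hM j, perF_W2OfK_comb (fine Lc M') (symTablesAn1S2 d Lc cΛ') cE cVH cΛ cE₂ cB T hM j,
    perF_W2OfK_comb (fine Lc M') (symTablesAn1S2 d Lc cΛ') cE cVH cΛ cE₂ cB T hM j, ← smul_add]
  congr 1
  abel

omit [∀ μ, NeZero (M' μ)] in
/-- [folklore] **AT an1's RECORD THE CROWN's BORDER COMPANION HAS NO COARSE `ff` ENTRY** (generic `d`; `SymSecondOrderTablesAn1.symTablesAn1S2_vh₂S_inl_inl` by `rfl`;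
an2's `CombHId2TorusRecordAn1.border₂_an1_inl_inl_eq_zero` is the `d = 3` print): the `v ⊗ v`-contracted periodised border vanishes at `(inl, inl)`. -/
theorem border₂_ff_sum_eq_zero (v : ↥(pbox M') × Fin (d + 1) → ℝ) (y₁ y₂ : ↥(pbox M')) (m₁ m₂ : Fin (d + 1)) :
    ∑ b : ↥(pbox M') × Fin (d + 1), ∑ b' : ↥(pbox M') × Fin (d + 1), (v b * v b')
        * perF M' (dper M' (fun x z a c => ∑' n, (symTablesAn1S2 d Lc cΛ').vh₂S b.2 (b.1 : Site (d + 1)) b'.2 (translate M' (b'.1 : Site (d + 1)) n) x z a c))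
            (y₁, Sum.inl m₁) (y₂, Sum.inl m₂) = 0 := by
  refine Finset.sum_eq_zero fun b _ => Finset.sum_eq_zero fun b' _ => ?_
  have h0 : perF M' (dper M' (fun x z a c => ∑' n, (symTablesAn1S2 d Lc cΛ').vh₂S b.2 (b.1 : Site (d + 1)) b'.2 (translate M' (b'.1 : Site (d + 1)) n) x z a c))
      (y₁, Sum.inl m₁) (y₂, Sum.inl m₂) = 0 := by
    simp only [perF_apply, perZ_apply, dper_apply, symTablesAn1S2_vh₂S_inl_inl, tsum_zero]
  rw [h0, mul_zero]

end Letters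

/-! ## §2 (P0) at the torus: the door's `Θᴸ = −Θᵀ` and `Ŝᵀ = Ŝ` for the comb-chart resolvent — the response border's share is antisymmetric -/

section Parity

omit [∀ μ, NeZero (M' μ)] in
/-- [folklore] **(P0-mm) THE COMB-CHART RESOLVENT's MULTIPLIER BLOCK IS SYMMETRIC ON THE TORUS** (any box `M` with `Lc ∣ M_i`): lattice parity
`CombChartWardSockets.trK_GcombSh` at `(inr, inr)` (`sgnF inr · sgnF inr = 1`) + period invariance `CombHId2Record.translate_inv_GcombSh` + 2d `perF_twin_of_twin`. -/
theorem perF_GcombSh_inr_inr_symm (M : Fin (d + 1) → ℕ) (hLM : ∀ i, Lc ∣ M i) (j : ℕ) (xbar zbar : ↥(pbox M)) (m m' : Fin (d + 1)) :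
    perF M (GcombSh (d := d) Lc j) (xbar, Sum.inr m) (zbar, Sum.inr m') = perF M (GcombSh (d := d) Lc j) (zbar, Sum.inr m') (xbar, Sum.inr m) := by
  refine perF_twin_of_twin M (translate_inv_GcombSh M hLM j) (fun x z => ?_) xbar zbar
  have h := congrFun (congrFun (congrFun (congrFun (trK_GcombSh (d := d) (Lc := Lc) j) z) x) (Sum.inr m')) (Sum.inr m)
  rw [trK_apply, sgnK_apply, sgnF_inr, sgnF_inr] at h
  rw [h]
  ring

omit [∀ μ, NeZero (M' μ)] in
/-- [folklore] **(P0) FOR THE DOOR's BINDERS — `Θᴸ = −Θᵀ`** (2d (L0) `CombHId2TorusTwin.perF_GcombSh_border_antitwin` under the axial masks). -/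
theorem door_ΘL_eq_neg_transpose (j : ℕ)
    {Θ : Matrix (↥(pbox (fine Lc M')) × Fin (d + 1)) (↥(pbox M') × Fin (d + 1)) ℝ}
    {ΘL : Matrix (↥(pbox M') × Fin (d + 1)) (↥(pbox (fine Lc M')) × Fin (d + 1)) ℝ}
    (hΘ : Θ = Matrix.of fun (b : ↥(pbox (fine Lc M')) × Fin (d + 1)) (a : ↥(pbox M') × Fin (d + 1)) =>
        axEc (ctr (d + 1) Lc) Lc (b.1 : Site (d + 1)) (b.1 : Site (d + 1)) (Sum.inl b.2) (Sum.inl b.2)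
          * perF (fine Lc M') (GcombSh (d := d) Lc j) (b.1, Sum.inl b.2) (coarsePt M' Lc a.1, Sum.inr a.2))
    (hΘL : ΘL = Matrix.of fun (a : ↥(pbox M') × Fin (d + 1)) (b : ↥(pbox (fine Lc M')) × Fin (d + 1)) =>
        axEc (ctr (d + 1) Lc) Lc (b.1 : Site (d + 1)) (b.1 : Site (d + 1)) (Sum.inl b.2) (Sum.inl b.2)
          * perF (fine Lc M') (GcombSh (d := d) Lc j) (coarsePt M' Lc a.1, Sum.inr a.2) (b.1, Sum.inl b.2)) :
    ΘL = -Θᵀ := by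
  subst hΘ hΘL
  ext a b
  simp only [Matrix.of_apply, Matrix.neg_apply, Matrix.transpose_apply]
  rw [perF_GcombSh_border_antitwin (fine Lc M') (fun i => ⟨M' i, rfl⟩) j (coarsePt M' Lc a.1) b.1 b.2 a.2]
  ring

omit [∀ μ, NeZero (M' μ)] in
/-- [folklore] **(P0) FOR THE DOOR's BINDERS — `Ŝᵀ = Ŝ`** (`perF_GcombSh_inr_inr_symm` at the coarse slots). -/
theorem door_Ŝ_transpose (j : ℕ) {Ŝ : Matrix (↥(pbox M') × Fin (d + 1)) (↥(pbox M') × Fin (d + 1)) ℝ}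
    (hŜ : Ŝ = (perF (fine Lc M') (GcombSh (d := d) Lc j)).submatrix
        (fun a : ↥(pbox M') × Fin (d + 1) => ((coarsePt M' Lc a.1, Sum.inr a.2) : Idx (fine Lc M') (Fib d)))
        (fun a : ↥(pbox M') × Fin (d + 1) => ((coarsePt M' Lc a.1, Sum.inr a.2) : Idx (fine Lc M') (Fib d)))) :
    Ŝᵀ = Ŝ := by
  subst hŜ
  ext a a'
  simp only [Matrix.transpose_apply, Matrix.submatrix_apply]
  exact perF_GcombSh_inr_inr_symm (fine Lc M') (fun i => ⟨M' i, rfl⟩) j (coarsePt M' Lc a'.1) (coarsePt M' Lc a.1) a'.2 a.2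

omit [∀ μ, NeZero (M' μ)] in
/-- [folklore] **THE RESPONSE BORDER's SHARE IS ANTISYMMETRIC FOR THE DOOR's BINDERS** (J2-record `responseBorder_transpose` at (P0)): for ANY `Qᶻ`,
`(Θᴸ·Qᶻᵀ·Ŝ + Ŝ·Qᶻ·Θ)ᵀ = −(Θᴸ·Qᶻᵀ·Ŝ + Ŝ·Qᶻ·Θ)` — it drops from every SYMMETRIC reading of the `μμ` block (the door's `c • H′₂`). -/
theorem door_responseBorder_transpose (j : ℕ)
    {Θ : Matrix (↥(pbox (fine Lc M')) × Fin (d + 1)) (↥(pbox M') × Fin (d + 1)) ℝ}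
    {ΘL : Matrix (↥(pbox M') × Fin (d + 1)) (↥(pbox (fine Lc M')) × Fin (d + 1)) ℝ} {Ŝ : Matrix (↥(pbox M') × Fin (d + 1)) (↥(pbox M') × Fin (d + 1)) ℝ}
    (hΘ : Θ = Matrix.of fun (b : ↥(pbox (fine Lc M')) × Fin (d + 1)) (a : ↥(pbox M') × Fin (d + 1)) =>
        axEc (ctr (d + 1) Lc) Lc (b.1 : Site (d + 1)) (b.1 : Site (d + 1)) (Sum.inl b.2) (Sum.inl b.2)
          * perF (fine Lc M') (GcombSh (d := d) Lc j) (b.1, Sum.inl b.2) (coarsePt M' Lc a.1, Sum.inr a.2))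
    (hΘL : ΘL = Matrix.of fun (a : ↥(pbox M') × Fin (d + 1)) (b : ↥(pbox (fine Lc M')) × Fin (d + 1)) =>
        axEc (ctr (d + 1) Lc) Lc (b.1 : Site (d + 1)) (b.1 : Site (d + 1)) (Sum.inl b.2) (Sum.inl b.2)
          * perF (fine Lc M') (GcombSh (d := d) Lc j) (coarsePt M' Lc a.1, Sum.inr a.2) (b.1, Sum.inl b.2))
    (hŜ : Ŝ = (perF (fine Lc M') (GcombSh (d := d) Lc j)).submatrix
        (fun a : ↥(pbox M') × Fin (d + 1) => ((coarsePt M' Lc a.1, Sum.inr a.2) : Idx (fine Lc M') (Fib d)))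
        (fun a : ↥(pbox M') × Fin (d + 1) => ((coarsePt M' Lc a.1, Sum.inr a.2) : Idx (fine Lc M') (Fib d))))
    (Qz : Matrix (↥(pbox M') × Fin (d + 1)) (↥(pbox (fine Lc M')) × Fin (d + 1)) ℝ) :
    (ΘL * Qzᵀ * Ŝ + Ŝ * Qz * Θ)ᵀ = -(ΘL * Qzᵀ * Ŝ + Ŝ * Qz * Θ) :=
  responseBorder_transpose Θ ΘL Ŝ Qz (door_ΘL_eq_neg_transpose M' j hΘ hΘL) (door_Ŝ_transpose M' j hŜ)

end Parity

/-! ## §3 The door's `hId₂` polynomial at an1's record, closed form -/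

section Assembly

set_option synthInstance.maxSize 1024 in
set_option maxHeartbeats 800000 in
/-- **[folklore] `torus_thetaWord_record_an1` — THE DOOR's `hId₂` AT an1's RECORD `tabs := symTablesAn1S2 d Lc cΛ′`, CLOSED FORM** (J2-record `torus_thetaWord_record_comb` with
`hsplit` := `Wh_split`, the six sockets := `Dh_blocks ∕ Ws_blocks ∕ Wz_blocks`, the border companion := `0` by `border₂_ff_sum_eq_zero`).  On the fine box `F = fine Lc M′`
with U21's coarse slots `fμ a := (coarsePt M′ Lc a.1, inr a.2)` and field slots `fs b := (b.1, inl b.2)`: the door's `Θ Θᴸ Ŝ Γ̂` binders (VERBATIM); the first jet `D̂_{b̄}` (`hDh`), the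
slot word `Ŵ^{slots}_{b̄b̄′}` (`hWs`: the symmetrised bi-vertex + mixed words) and the symmetrised response word `Ẑ_{b̄b̄′}` (`hWz`) in an2's spelling; the direction `v`; the jets READ
`H₁ := D̂_v∘(fs,fs)`, `Q₁₁ := D̂_v∘(fμ,fs)`, `H₂ := Ŵ^{slots}_{vv}∘(fs,fs)`, `Q₁₂ := Ŵ^{slots}_{vv}∘(fμ,fs)`, `Hᶻ := Ẑ_{vv}∘(fs,fs)`, `Qᶻ := Ẑ_{vv}∘(fμ,fs)`.  THEN for all coarse slots `a₁ a₂`: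
`(cE₂·wV4 (j+1)) · (P(Θ, Θᴸ, Ŝ, Γ̂; H₁, H₂, Q₁₁, Q₁₂) − (Θᴸ·Hᶻ·Θ + Θᴸ·Qᶻᵀ·Ŝ + Ŝ·Qᶻ·Θ)) a₁ a₂ = Σ_{b̄ b̄′} v_{b̄} v_{b̄′} · perF M′ (dper M′ (T2_{j+1} b̄ b̄′ copy-summed)) (a₁.1, inl a₁.2) (a₂.1, inl a₂.2)`
— NO socket, NO border term (`door_responseBorder_transpose`: the response sandwich's border share is antisymmetric). -/
theorem torus_thetaWord_record_an1 (j : ℕ)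
    {Θ : Matrix (↥(pbox (fine Lc M')) × Fin (d + 1)) (↥(pbox M') × Fin (d + 1)) ℝ}
    {ΘL : Matrix (↥(pbox M') × Fin (d + 1)) (↥(pbox (fine Lc M')) × Fin (d + 1)) ℝ} {Ŝ : Matrix (↥(pbox M') × Fin (d + 1)) (↥(pbox M') × Fin (d + 1)) ℝ}
    {Γc : Matrix (↥(pbox (fine Lc M')) × Fin (d + 1)) (↥(pbox (fine Lc M')) × Fin (d + 1)) ℝ}
    (hΘ : Θ = Matrix.of fun (b : ↥(pbox (fine Lc M')) × Fin (d + 1)) (a : ↥(pbox M') × Fin (d + 1)) =>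
        axEc (ctr (d + 1) Lc) Lc (b.1 : Site (d + 1)) (b.1 : Site (d + 1)) (Sum.inl b.2) (Sum.inl b.2)
          * perF (fine Lc M') (GcombSh (d := d) Lc j) (b.1, Sum.inl b.2) (coarsePt M' Lc a.1, Sum.inr a.2))
    (hΘL : ΘL = Matrix.of fun (a : ↥(pbox M') × Fin (d + 1)) (b : ↥(pbox (fine Lc M')) × Fin (d + 1)) =>
        axEc (ctr (d + 1) Lc) Lc (b.1 : Site (d + 1)) (b.1 : Site (d + 1)) (Sum.inl b.2) (Sum.inl b.2)
          * perF (fine Lc M') (GcombSh (d := d) Lc j) (coarsePt M' Lc a.1, Sum.inr a.2) (b.1, Sum.inl b.2))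
    (hŜ : Ŝ = (perF (fine Lc M') (GcombSh (d := d) Lc j)).submatrix
        (fun a : ↥(pbox M') × Fin (d + 1) => ((coarsePt M' Lc a.1, Sum.inr a.2) : Idx (fine Lc M') (Fib d)))
        (fun a : ↥(pbox M') × Fin (d + 1) => ((coarsePt M' Lc a.1, Sum.inr a.2) : Idx (fine Lc M') (Fib d))))
    (hΓc : Γc = Matrix.of fun (b b' : ↥(pbox (fine Lc M')) × Fin (d + 1)) =>
        axEc (ctr (d + 1) Lc) Lc (b.1 : Site (d + 1)) (b.1 : Site (d + 1)) (Sum.inl b.2) (Sum.inl b.2)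
          * (axEc (ctr (d + 1) Lc) Lc (b'.1 : Site (d + 1)) (b'.1 : Site (d + 1)) (Sum.inl b'.2) (Sum.inl b'.2)
            * perF (fine Lc M') (GcombSh (d := d) Lc j) (b.1, Sum.inl b.2) (b'.1, Sum.inl b'.2)))
    -- an2's words at an1's record: the first jet, the slot word (symmetrised), the response word (symmetrised)
    {Dh : ↥(pbox M') × Fin (d + 1) → Matrix (Idx (fine Lc M') (Fib d)) (Idx (fine Lc M') (Fib d)) ℝ}
    (hDh : Dh = fun b => perF (fine Lc M') (dM (GcombSh (d := d) Lc j) Lc (fun κ u => dper (fine Lc M') (SpureCombOf (symTablesAn1S2 d Lc cΛ') cE cVH cΛ j κ u))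
        (fun ρ w => dper (fine Lc M') ((symTablesAn1S2 d Lc cΛ').M j ρ w)) b.2 (b.1 : Site (d + 1))))
    {Ws Wz : ↥(pbox M') × Fin (d + 1) → ↥(pbox M') × Fin (d + 1) → Matrix (Idx (fine Lc M') (Fib d)) (Idx (fine Lc M') (Fib d)) ℝ}
    (hWs : Ws = fun b b' => (1 / 2 : ℝ) •
        ((perF (fine Lc M') (vertex2OfK (GcombSh (d := d) Lc j) Lc (fun κ u κ' u' => dper (fine Lc M') (fun x z a c => ∑' n : Site (d + 1),
              T2RecOf d Lc (GcombSh Lc) (SpureCombOf (symTablesAn1S2 d Lc cΛ') cE cVH cΛ) (symTablesAn1S2 d Lc cΛ').M cE₂ cB T (symTablesAn1S2 d Lc cΛ').vh₂S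
                (symTablesAn1S2 d Lc cΛ').mixFF j κ u κ' (translate (fine Lc M') u' n) x z a c)) b.2 (b.1 : Site (d + 1)) b'.2 (b'.1 : Site (d + 1)))
            + perF (fine Lc M') (mixOfK (GcombSh (d := d) Lc j) Lc
                (fun κ u ρ w => dper (fine Lc M') (fun x z a c => ∑' n : Site (d + 1), M2Of d Lc (symTablesAn1S2 d Lc cΛ').mixFF j κ u ρ (translate M' w n) x z a c))
                b.2 (b.1 : Site (d + 1)) b'.2 (b'.1 : Site (d + 1)))
            + perF (fine Lc M') (mixOfK (GcombSh (d := d) Lc j) Lc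
                (fun κ u ρ w => dper (fine Lc M') (fun x z a c => ∑' n : Site (d + 1), M2Of d Lc (symTablesAn1S2 d Lc cΛ').mixFF j κ u ρ (translate M' w n) x z a c))
                b'.2 (b'.1 : Site (d + 1)) b.2 (b.1 : Site (d + 1))))
          + (perF (fine Lc M') (vertex2OfK (GcombSh (d := d) Lc j) Lc (fun κ u κ' u' => dper (fine Lc M') (fun x z a c => ∑' n : Site (d + 1),
              T2RecOf d Lc (GcombSh Lc) (SpureCombOf (symTablesAn1S2 d Lc cΛ') cE cVH cΛ) (symTablesAn1S2 d Lc cΛ').M cE₂ cB T (symTablesAn1S2 d Lc cΛ').vh₂S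
                (symTablesAn1S2 d Lc cΛ').mixFF j κ u κ' (translate (fine Lc M') u' n) x z a c)) b'.2 (b'.1 : Site (d + 1)) b.2 (b.1 : Site (d + 1)))
            + perF (fine Lc M') (mixOfK (GcombSh (d := d) Lc j) Lc
                (fun κ u ρ w => dper (fine Lc M') (fun x z a c => ∑' n : Site (d + 1), M2Of d Lc (symTablesAn1S2 d Lc cΛ').mixFF j κ u ρ (translate M' w n) x z a c))
                b'.2 (b'.1 : Site (d + 1)) b.2 (b.1 : Site (d + 1)))
            + perF (fine Lc M') (mixOfK (GcombSh (d := d) Lc j) Lc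
                (fun κ u ρ w => dper (fine Lc M') (fun x z a c => ∑' n : Site (d + 1), M2Of d Lc (symTablesAn1S2 d Lc cΛ').mixFF j κ u ρ (translate M' w n) x z a c))
                b.2 (b.1 : Site (d + 1)) b'.2 (b'.1 : Site (d + 1))))))
    (hWz : Wz = fun b b' => (1 / 2 : ℝ) •
        (perF (fine Lc M') (dM (K2OfK (GcombSh (d := d) Lc j) Lc (fun κ u => dper (fine Lc M') (SpureCombOf (symTablesAn1S2 d Lc cΛ') cE cVH cΛ j κ u))
              (fun ρ w => dper (fine Lc M') ((symTablesAn1S2 d Lc cΛ').M j ρ w)) b'.2 (b'.1 : Site (d + 1))) Lc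
            (fun κ u => dper (fine Lc M') (SpureCombOf (symTablesAn1S2 d Lc cΛ') cE cVH cΛ j κ u)) (fun ρ w => dper (fine Lc M') ((symTablesAn1S2 d Lc cΛ').M j ρ w))
            b.2 (b.1 : Site (d + 1)))
          + perF (fine Lc M') (dM (K2OfK (GcombSh (d := d) Lc j) Lc (fun κ u => dper (fine Lc M') (SpureCombOf (symTablesAn1S2 d Lc cΛ') cE cVH cΛ j κ u))
              (fun ρ w => dper (fine Lc M') ((symTablesAn1S2 d Lc cΛ').M j ρ w)) b.2 (b.1 : Site (d + 1))) Lc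
            (fun κ u => dper (fine Lc M') (SpureCombOf (symTablesAn1S2 d Lc cΛ') cE cVH cΛ j κ u)) (fun ρ w => dper (fine Lc M') ((symTablesAn1S2 d Lc cΛ').M j ρ w))
            b'.2 (b'.1 : Site (d + 1)))))
    -- the direction and the door's jets READ
    (v : ↥(pbox M') × Fin (d + 1) → ℝ)
    {H₁ H₂ : Matrix (↥(pbox (fine Lc M')) × Fin (d + 1)) (↥(pbox (fine Lc M')) × Fin (d + 1)) ℝ}
    {Q₁₁ Q₁₂ : Matrix (↥(pbox M') × Fin (d + 1)) (↥(pbox (fine Lc M')) × Fin (d + 1)) ℝ}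
    {Hz : Matrix (↥(pbox (fine Lc M')) × Fin (d + 1)) (↥(pbox (fine Lc M')) × Fin (d + 1)) ℝ} {Qz : Matrix (↥(pbox M') × Fin (d + 1)) (↥(pbox (fine Lc M')) × Fin (d + 1)) ℝ}
    (hH₁ : H₁ = (∑ b, v b • Dh b).submatrix (fun b : ↥(pbox (fine Lc M')) × Fin (d + 1) => ((b.1, Sum.inl b.2) : Idx (fine Lc M') (Fib d)))
        (fun b : ↥(pbox (fine Lc M')) × Fin (d + 1) => ((b.1, Sum.inl b.2) : Idx (fine Lc M') (Fib d))))
    (hQ₁₁ : Q₁₁ = (∑ b, v b • Dh b).submatrix (fun a : ↥(pbox M') × Fin (d + 1) => ((coarsePt M' Lc a.1, Sum.inr a.2) : Idx (fine Lc M') (Fib d)))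
        (fun b : ↥(pbox (fine Lc M')) × Fin (d + 1) => ((b.1, Sum.inl b.2) : Idx (fine Lc M') (Fib d))))
    (hH₂ : H₂ = (∑ b, ∑ b', (v b * v b') • Ws b b').submatrix (fun b : ↥(pbox (fine Lc M')) × Fin (d + 1) => ((b.1, Sum.inl b.2) : Idx (fine Lc M') (Fib d)))
        (fun b : ↥(pbox (fine Lc M')) × Fin (d + 1) => ((b.1, Sum.inl b.2) : Idx (fine Lc M') (Fib d))))
    (hQ₁₂ : Q₁₂ = (∑ b, ∑ b', (v b * v b') • Ws b b').submatrix (fun a : ↥(pbox M') × Fin (d + 1) => ((coarsePt M' Lc a.1, Sum.inr a.2) : Idx (fine Lc M') (Fib d)))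
        (fun b : ↥(pbox (fine Lc M')) × Fin (d + 1) => ((b.1, Sum.inl b.2) : Idx (fine Lc M') (Fib d))))
    (hHz : Hz = (∑ b, ∑ b', (v b * v b') • Wz b b').submatrix (fun b : ↥(pbox (fine Lc M')) × Fin (d + 1) => ((b.1, Sum.inl b.2) : Idx (fine Lc M') (Fib d)))
        (fun b : ↥(pbox (fine Lc M')) × Fin (d + 1) => ((b.1, Sum.inl b.2) : Idx (fine Lc M') (Fib d))))
    (hQz : Qz = (∑ b, ∑ b', (v b * v b') • Wz b b').submatrix (fun a : ↥(pbox M') × Fin (d + 1) => ((coarsePt M' Lc a.1, Sum.inr a.2) : Idx (fine Lc M') (Fib d)))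
        (fun b : ↥(pbox (fine Lc M')) × Fin (d + 1) => ((b.1, Sum.inl b.2) : Idx (fine Lc M') (Fib d))))
    (a₁ a₂ : ↥(pbox M') × Fin (d + 1)) :
    (cE₂ * wV4 d Lc (j + 1)) *
      ((((-((-ΘL * H₁ - Ŝ * Q₁₁) * Γc - -ΘL * Q₁₁ᵀ * -ΘL) * H₁ + -ΘL * H₂
          - (((-ΘL * H₁ - Ŝ * Q₁₁) * Θ + -ΘL * Q₁₁ᵀ * Ŝ) * Q₁₁ + Ŝ * Q₁₂)) * Θ
        + (-ΘL * H₁ - Ŝ * Q₁₁) * (-((Γc * H₁ + Θ * Q₁₁) * Θ + Γc * Q₁₁ᵀ * Ŝ)))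
      - ((-((-ΘL * H₁ - Ŝ * Q₁₁) * Γc - -ΘL * Q₁₁ᵀ * -ΘL) * (-Q₁₁ᵀ) + -ΘL * Q₁₂ᵀ) * Ŝ
          + -ΘL * (-Q₁₁ᵀ) * ((-ΘL * H₁ - Ŝ * Q₁₁) * Θ + -ΘL * Q₁₁ᵀ * Ŝ)))
        - (ΘL * Hz * Θ + ΘL * Qzᵀ * Ŝ + Ŝ * Qz * Θ)) a₁ a₂
      = ∑ b : ↥(pbox M') × Fin (d + 1), ∑ b' : ↥(pbox M') × Fin (d + 1), (v b * v b')
          * perF M' (dper M' (fun x z a c => ∑' n, T2RecOf d Lc (GcombSh Lc) (SpureCombOf (symTablesAn1S2 d Lc cΛ') cE cVH cΛ) (symTablesAn1S2 d Lc cΛ').M cE₂ cB T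
              (symTablesAn1S2 d Lc cΛ').vh₂S (symTablesAn1S2 d Lc cΛ').mixFF (j + 1)
              b.2 (b.1 : Site (d + 1)) b'.2 (translate M' (b'.1 : Site (d + 1)) n) x z a c)) (a₁.1, Sum.inl a₁.2) (a₂.1, Sum.inl a₂.2) := by
  have h := torus_thetaWord_record_comb (symTablesAn1S2 d Lc cΛ') cE cVH cΛ cE₂ cB T j hΘ hΘL hŜ hΓc hDh rfl (Ws := Ws) (Wz := Wz)
    (fun b b' => by rw [hWs, hWz]; exact Wh_split M' cΛ' cE cVH cΛ cE₂ cB T j b b')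
    (Dh_blocks M' cΛ' cE cVH cΛ j hDh).1 (Dh_blocks M' cΛ' cE cVH cΛ j hDh).2 (Ws_blocks M' cΛ' cE cVH cΛ cE₂ cB T j hWs).1
    (Ws_blocks M' cΛ' cE cVH cΛ cE₂ cB T j hWs).2 (Wz_blocks M' cΛ' cE cVH cΛ j hWz).1 (Wz_blocks M' cΛ' cE cVH cΛ j hWz).2 v hH₁ hQ₁₁ hH₂ hQ₁₂ hHz hQz a₁ a₂
  rw [border₂_ff_sum_eq_zero, mul_zero, add_zero] at h
  exact h

end Assembly

end Summit.QuantumFields.BalabanUV.Beta.FP.CoarseJetOrderTwoGradedCombJunctionRecordAn1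

end
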